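import Literature.Computability.QuantumComplexity.PermanentSearchRandom
import Literature.Computability.QuantumComplexity.PermanentHardnessProofs
import Literature.Computability.QuantumComplexity.PermanentSearchRandomProofs
import HarnessLib

/-!
# Exact BosonSampling: discharge of AA13 Thm. 4.3 in randomised-oracle form

Family `quantum-advantage`; a proofs file of `ExactBosonSamplingHardness.lean` (pure proof, no new
declarations besides the discharge). The named fact `PSharpP_subset_BPPRel_of_perSqRandOracleSolves` there is
Aaronson–Arkhipov's Theorem 4.3 (*The computational complexity of linear optics*, Theory of Computing 9
(2013), p. 176 = arXiv:1011.3245 Thm. 28: "The following problem is #P-hard, for any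
`g ∈ [1, poly(n)]`: given a real matrix `X ∈ ℝ^{n×n}`, approximate `Per(X)²` to within a multiplicative
factor of `g`"), in the randomised-oracle form consumed by the proof of Thm. 1.1
(p. 178): for every real `g ≥ 1` and every coin-taking oracle `𝒪` that `g`-approximates `Per(X)²` of
integer matrices with failure probability `≤ 1/k` over its coins, `P^{#P} ⊆ BPP^{𝒪}`.

The printed proof (pp. 176–177: "we will show how to compute `Per(X)` exactly, in polynomial time and
using `O(g n² log n)` adaptive queries to `𝒪`") — a recursion on `n` along the first-row expansion
`Per(X^{[r]}) = Per(X) − r·Per(Y)`, a binary search halving the oracle's estimate each round,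
`O(n log n)` rounds, and a final rounding — then invokes Valiant's theorem (Thm. 4.2 = Valiant 1979,
Thm. 1: the `0/1` permanent is `#P`-complete).
In the tree this architecture is `PSharpP_subset_BPPRel_of_perSqRandOracleSolves_of_facts`
(`PermanentSearchRandom.lean`: the search and its correctness `PermanentSearch.lean`, its query/size
bounds `PermanentSearchRuns.lean`, the `BPP` machine, oracle composition and the fresh-coins/union-bound
estimate), proved from exactly two named facts, both of which are now theorems of the tree:

* `permanent01_isSharpPHardFun_holds` (`PermanentHardnessProofs.lean`) — Valiant's theorem, AA13 Thm. 4.2;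
* `PerSearch.randSearchAlg_isPolyTime_holds` (`PermanentSearchRandomProofs.lean`) — the search runs in
  polynomial time ("in polynomial time", p. 176).

This file feeds them in: **`PSharpP_subset_BPPRel_of_perSqRandOracleSolves_holds`**. (The fact's own file
cannot hold the discharge — `PermanentSearchRandom.lean` imports it — and the sibling
`ExactBosonSamplingHardnessProofs.lean` holds the discharge of Thm. 1.1 built on the same two theorems.)

## References

* S. Aaronson, A. Arkhipov, *The computational complexity of linear optics*, Theory of Computing 9
  (2013) 143–252, Thm. 4.3 (p. 176, proof pp. 176–177), Thm. 4.2 (p. 175), proof of Thm. 1.1 (p. 178);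
  arXiv:1011.3245, Thms. 27–28.
* L. G. Valiant, *The complexity of computing the permanent*, Theoret. Comput. Sci. 8 (1979) 189–201, Thm. 1.
-/

namespace Literature.Computability.QuantumComplexity

/-- **Aaronson–Arkhipov, Thm. 4.3 (randomised-oracle form), fully discharged**: for every real factor
`g ≥ 1` and every coin-taking oracle `𝒪` that `g`-approximates `Per(X)²` of integer matrices `X`
(failure probability `≤ 1/k` over its coins, `PerSqRandOracleSolves g 𝒪`), `P^{#P} ⊆ BPP^{𝒪}`. This is the
assembly `PSharpP_subset_BPPRel_of_perSqRandOracleSolves_of_facts` (`PermanentSearchRandom.lean`: the binary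
search of the proof of Thm. 4.3 with its correctness, query/size bounds, the `BPP` machine and the
fresh-coins/union-bound estimate, all proved there) fed with the two ingredients it quotes, now theorems
of the tree: Valiant's theorem, AA13 Thm. 4.2 (`permanent01_isSharpPHardFun_holds`,
`PermanentHardnessProofs.lean`), and the polynomial running time of the search
(`PerSearch.randSearchAlg_isPolyTime_holds`, `PermanentSearchRandomProofs.lean`). [cite: AaronsonArkhipovToC2013, Thm. 4.3 (p. 176) with Thm. 4.2 (p. 175) and proof of Thm. 1.1 (p. 178)] -/
theorem PSharpP_subset_BPPRel_of_perSqRandOracleSolves_holds :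
    PSharpP_subset_BPPRel_of_perSqRandOracleSolves :=
  PSharpP_subset_BPPRel_of_perSqRandOracleSolves_of_facts permanent01_isSharpPHardFun_holds
    PerSearch.randSearchAlg_isPolyTime_holds

end Literature.Computability.QuantumComplexity
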